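/-
Copyright (c) 2026. All rights reserved.
Released under Apache 2.0 license as described in the file LICENSE.
-/
import Literature.NumberTheory.GelbartRogawski1991.UnitaryDualPairThetaKernelCM
import Literature.NumberTheory.GelbartRogawski1991.UnitaryDualPairGramDiagonal
import HarnessLib

-- buildfix G11b-3 recipe (LEDGER B13-1/B13-3): elaborate sequentially so the trailing `attribute [implicit_reducible]`
-- block (reducibilityCoreExt is keyed to the async environment branch) is in force at `.olean` export.
set_option Elab.async false

/-!
# The Gram matrix of the CM unitary dual pair at the diagonal pin

[folklore] bookkeeping, CM currency of `UnitaryDualPairThetaKernelCM`: for a CM field `L` with maximal real subfield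
`L⁺` and conjugation-fixed non-zero `dV : Fin N → L`, `dW : Fin M → L`, the Gram matrix of `Res_{L/L⁺}(V ⊗ W)` for the
diagonal hermitian forms `diag dV`, `diag dW` (real frames `realDiagonal`) in the enumeration `e : Fin N × Fin M ≃ Fin n` is
the DIAGONAL matrix with entries `t₀ k = dV (e⁻¹ k)₁ · dW (e⁻¹ k)₂ ∈ L⁺` (`cmGramEntry`), both over `L⁺`
(`gram_realDiagonal`) and adelically (`adelicGram_realDiagonal`), and it is a unit of `M_n(𝔸_{L⁺})`
(`isUnit_adelicGram_realDiagonal`).  These are the literal discharges, at the CM pin, of the hypotheses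
`T = diagonal t₀` of the archimedean Schrödinger–Folland torus dictionary
(`Literature.NumberTheory.Weil1964.ArchFollandTorusAdelic`) and `hT : IsUnit T` of Weil's majorant theorem
(`Literature.NumberTheory.Weil1964.hasThetaMajorants_omega_comp`), for the Gram matrix
`adelicGram L⁺ e (realDiagonal L dV hdV) (realDiagonal L dW hdW)` over which `cmPairSplitting` / `cmThetaKernelDatum` live.

No records, no `sorry`; [folklore] throughout ([GelbartRogawski1991] §3.1 p. 454 for the dual pair).
-/

noncomputable section

open scoped Matrix
open NumberField

namespace Literature.NumberTheory.GelbartRogawski1991.UnitaryDualPair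

variable (L : Type) [Field L] [NumberField L] [IsCMField L] {N M n : ℕ} (e : Fin N × Fin M ≃ Fin n)
variable (dV : Fin N → L) (hdV : ∀ i, IsCMField.complexConj L (dV i) = dV i)
variable (dW : Fin M → L) (hdW : ∀ i, IsCMField.complexConj L (dW i) = dW i)

/-- `t₀ k := dV (e⁻¹ k)₁ · dW (e⁻¹ k)₂ ∈ L⁺`: the `k`-th Gram entry of `Res(V ⊗ W)` at the diagonal CM pin. [folklore] -/
def cmGramEntry (k : Fin n) : ↥(maximalRealSubfield L) :=
  (⟨dV (e.symm k).1, (IsCMField.complexConj_eq_self_iff (K := L) (dV (e.symm k).1)).1 (hdV _)⟩ :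
      ↥(maximalRealSubfield L)) *
    ⟨dW (e.symm k).2, (IsCMField.complexConj_eq_self_iff (K := L) (dW (e.symm k).2)).1 (hdW _)⟩

/-- `t₀ k = dV (e⁻¹ k)₁ · dW (e⁻¹ k)₂` in `L`. [folklore] -/
@[simp] theorem coe_cmGramEntry (k : Fin n) :
    ((cmGramEntry L e dV hdV dW hdW k : ↥(maximalRealSubfield L)) : L) = dV (e.symm k).1 * dW (e.symm k).2 := rfl

/-- `t₀ k ≠ 0` when no `dV i`, `dW j` vanishes. [folklore] -/
theorem cmGramEntry_ne_zero (hdV0 : ∀ i, dV i ≠ 0) (hdW0 : ∀ i, dW i ≠ 0) (k : Fin n) :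
    cmGramEntry L e dV hdV dW hdW k ≠ 0 := fun h =>
  mul_ne_zero (hdV0 (e.symm k).1) (hdW0 (e.symm k).2)
    ((coe_cmGramEntry L e dV hdV dW hdW k).symm.trans (congrArg Subtype.val h))

/-- `𝕋_{L⁺} = diag t₀` at the diagonal CM pin. [folklore] -/
theorem gram_realDiagonal :
    gram (↥(maximalRealSubfield L)) e (realDiagonal L dV hdV) (realDiagonal L dW hdW) =
      Matrix.diagonal (cmGramEntry L e dV hdV dW hdW) := by
  unfold realDiagonal cmGramEntry
  exact gram_diagonal _ e _ _

/-- `𝕋 = diag (t₀ ⊗ 1) ∈ M_n(𝔸_{L⁺})` at the diagonal CM pin — the `T = diagonal t₀` of the archimedean torus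
dictionary. [folklore] -/
theorem adelicGram_realDiagonal :
    adelicGram (↥(maximalRealSubfield L)) e (realDiagonal L dV hdV) (realDiagonal L dW hdW) =
      Matrix.diagonal fun k =>
        algebraMap (↥(maximalRealSubfield L)) (AdeleRing (𝓞 ↥(maximalRealSubfield L)) ↥(maximalRealSubfield L))
          (cmGramEntry L e dV hdV dW hdW k) := by
  unfold realDiagonal cmGramEntry
  exact adelicGram_diagonal' _ e _ _

/-- The same as `(diag t₀).map (algebraMap L⁺ 𝔸_{L⁺})`. [folklore] -/
theorem adelicGram_realDiagonal_eq_map :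
    adelicGram (↥(maximalRealSubfield L)) e (realDiagonal L dV hdV) (realDiagonal L dW hdW) =
      (Matrix.diagonal (cmGramEntry L e dV hdV dW hdW)).map
        (algebraMap (↥(maximalRealSubfield L)) (AdeleRing (𝓞 ↥(maximalRealSubfield L)) ↥(maximalRealSubfield L))) := by
  rw [adelicGram_eq_map, gram_realDiagonal]

/-- `𝕋_{L⁺} ∈ GL_n(L⁺)` (matrix unit) at the pin. [folklore] -/
theorem isUnit_gram_realDiagonal (hdV0 : ∀ i, dV i ≠ 0) (hdW0 : ∀ i, dW i ≠ 0) :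
    IsUnit (gram (↥(maximalRealSubfield L)) e (realDiagonal L dV hdV) (realDiagonal L dW hdW)) :=
  isUnit_gram _ e (isUnit_det_realDiagonal L dV hdV hdV0) (isUnit_det_realDiagonal L dW hdW hdW0)

/-- `𝕋 ∈ GL_n(𝔸_{L⁺})` (matrix unit) at the pin — the `hT : IsUnit T` of
`Literature.NumberTheory.Weil1964.hasThetaMajorants_omega_comp` for `T = adelicGram L⁺ e (realDiagonal …) (realDiagonal …)`,
the Gram matrix of `cmPairSplitting` / `cmThetaKernelDatum`. [folklore] -/
theorem isUnit_adelicGram_realDiagonal (hdV0 : ∀ i, dV i ≠ 0) (hdW0 : ∀ i, dW i ≠ 0) :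
    IsUnit (adelicGram (↥(maximalRealSubfield L)) e (realDiagonal L dV hdV) (realDiagonal L dW hdW)) :=
  isUnit_adelicGram _ e (isUnit_det_realDiagonal L dV hdV hdV0) (isUnit_det_realDiagonal L dW hdW hdW0)

/-! ### Build-lane note (ops-buildfix G11b-3 recipe, LEDGER B13-1, 2026-08-21)
`lean -o` (the hub build lane, never `lean`/the gate check) runs Lean 4.32's library-suggestion indexers
(`Lean.LibrarySuggestions.SymbolFrequency` / `SineQuaNon`, from their `exportEntriesFn`) over the statement of
every local theorem that is not a denied premise; on this family's statements (very large dependent binder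
telescopes through the theta-kernel / dual-pair data) that fold runs for tens of minutes to hours and the build
lane kills the job (incident G11b-3, run/shared/lean/ops/buildfix/G11b-3-DOSSIER.md). `isDeniedPremise` skips
`[implicit_reducible]` constants before any fold, and a reducibility status on a *theorem* is inert (Meta never
unfolds `thmInfo`; the kernel ignores the attribute), so the public theorems of this file are tagged
`[implicit_reducible]` purely to keep them out of that index. Only other effect: they are not offered by
`+suggestions` premise selectors. No statement or proof is changed; superseded if the operator lands a
deny-list form (`HarnessLib.PremiseIndex`). -/
set_option allowUnsafeReducibility true in
attribute [implicit_reducible]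
  coe_cmGramEntry cmGramEntry_ne_zero gram_realDiagonal adelicGram_realDiagonal
  adelicGram_realDiagonal_eq_map isUnit_gram_realDiagonal isUnit_adelicGram_realDiagonal

end Literature.NumberTheory.GelbartRogawski1991.UnitaryDualPair

end
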